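import Summits.CriticalPhenomena.PercolationContinuityZ3.Theorems.PercNearOneGluingAdditiveGluingFingerTwoTouched
import HarnessLib

/-! # Crux `PercNearOneGluing.AdditiveGluing` (stmt-CriticalPhenomena-4576) — fingers touching at most two relays, one of which may be `b`
# (seat (b) V⁺-form, depth prover `png-dp-vplus`)

Support file (`--supports stmt-CriticalPhenomena-4576`); no definitions, no named facts.

`fingerML3_twoTouched_withB`: `fingerML3_twoTouched` without the restriction `w₁, w₂ ≠ b`: if one of the two touched relays is the target `b`,
the reduced relay set `{b, d, w}` has at most three elements and `fingerML3_of_card_le_three` applies (fingers touching `b` are allowed there).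
[cite: KozmaNitzan2024, Lemma 3 (pp. 6–7), §3.2 pp. 12–14, Question 9 (p. 36)]
-/

namespace Summit.CriticalPhenomena.PercolationContinuityZ3.Theorems

open MeasureTheory Set
open Literature.Probability.LatticeModels (prodBernoulli)
open Literature.Probability.Percolation (BondConfig openConn openGraph)

noncomputable section
open Classical

section FingerTwoTouchedB

open Literature.Probability.LatticeModels Literature.Probability.Percolation

variable {n : ℕ}

/-- `stub_fingerML3_vp` when the fingers touch only `b` and one further relay `w` (any `A`): reduction to `fingerML3_of_card_le_three` on `{b, d, w}`.
[cite: KozmaNitzan2024, Lemma 3 (pp. 6–7), §3.2 pp. 12–14] -/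
theorem fingerML3_touched_b_and_one (K : Sym2 (Fin n) → unitInterval) (A N : Finset (Fin n)) (d b w : Fin n)
    (hb : b ∈ A) (hNA : Disjoint N A) (hd : d ∈ A)
    (hfree : ∀ v ∈ N, ∀ y : Fin n, y ∉ A → y ∉ N → (K s(v, y) : ℝ) = 0)
    (hle : ∀ a ∈ A, (prodBernoulli K).real (openConn d b) ≤ (prodBernoulli K).real (openConn a b))
    (htwo : ∀ v ∈ N, ∀ a ∈ A, a ≠ w → a ≠ b → (K s(v, a) : ℝ) = 0) :
    (prodBernoulli (fun e' : Sym2 (Fin n) => if (∀ y ∈ e', y ∈ N) ∧ ¬ e'.IsDiag then 1 else K e')).real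
        ({ω : Set (Sym2 (Fin n)) | ∃ v ∈ N, ∃ a ∈ A, s(v, a) ∈ ω} ∩ openConn d b) ≤
      (prodBernoulli (fun e' : Sym2 (Fin n) => if (∀ y ∈ e', y ∈ N) ∧ ¬ e'.IsDiag then 1 else K e')).real
        ({ω : Set (Sym2 (Fin n)) | ∃ v ∈ N, ∃ a ∈ A, s(v, a) ∈ ω} ∩ ⋃ v ∈ N, openConn v b) := by
  set g : Sym2 (Fin n) → unitInterval := fun e' => if (∀ y ∈ e', y ∈ N) ∧ ¬ e'.IsDiag then 1 else K e' with hg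
  set A' : Finset (Fin n) := insert b (insert d (A.filter fun a => a = w)) with hA'def
  have hA'sub : A' ⊆ A := by
    intro a ha
    rcases Finset.mem_insert.1 ha with rfl | ha
    · exact hb
    rcases Finset.mem_insert.1 ha with rfl | ha
    · exact hd
    exact (Finset.mem_filter.1 ha).1
  have hb' : b ∈ A' := Finset.mem_insert_self _ _
  have hd' : d ∈ A' := Finset.mem_insert_of_mem (Finset.mem_insert_self _ _)
  have hNA' : Disjoint N A' := hNA.mono_right hA'sub
  have hcard : A'.card ≤ 3 := by
    have h1 : (A.filter fun a => a = w).card ≤ 1 := by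
      calc (A.filter fun a => a = w).card ≤ ({w} : Finset (Fin n)).card :=
            Finset.card_le_card fun a ha => by rw [(Finset.mem_filter.1 ha).2]; exact Finset.mem_singleton_self _
        _ = 1 := Finset.card_singleton w
    have h2 := Finset.card_insert_le d (A.filter fun a => a = w)
    have h3 := Finset.card_insert_le b (insert d (A.filter fun a => a = w))
    have h4 : A'.card = (insert b (insert d (A.filter fun a => a = w))).card := rfl
    omega
  have hout : ∀ a ∈ A, a ∉ A' → a ≠ w ∧ a ≠ b := by
    intro a ha haA'
    constructor
    · rintro rfl
      exact haA' (Finset.mem_insert_of_mem (Finset.mem_insert_of_mem (Finset.mem_filter.2 ⟨ha, rfl⟩)))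
    · rintro rfl
      exact haA' hb'
  have hfree' : ∀ v ∈ N, ∀ y : Fin n, y ∉ A' → y ∉ N → (K s(v, y) : ℝ) = 0 := by
    intro v hv y hyA' hyN
    by_cases hyA : y ∈ A
    · obtain ⟨h1, h2⟩ := hout y hyA hyA'
      exact htwo v hv y hyA h1 h2
    · exact hfree v hv y hyA hyN
  have hle' : ∀ a ∈ A', (prodBernoulli K).real (openConn d b) ≤ (prodBernoulli K).real (openConn a b) :=
    fun a ha => hle a (hA'sub ha)
  have h3 := fingerML3_of_card_le_three K A' N d b hb' hNA' hd' hcard hfree' hle'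
  have hg0 : ∀ v ∈ N, ∀ a ∈ A, a ∉ A' → g s(v, a) = 0 := by
    intro v hv a ha haA'
    have haN : a ∉ N := Finset.disjoint_left.1 hNA.symm ha
    have hnot : ¬ ((∀ y ∈ s(v, a), y ∈ N) ∧ ¬ (s(v, a)).IsDiag) := fun h => haN (h.1 a (Sym2.mem_mk_right v a))
    simp only [hg, hnot, if_false]
    obtain ⟨h1, h2⟩ := hout a ha haA'
    exact Set.Icc.coe_eq_zero.1 (htwo v hv a ha h1 h2)
  rw [real_fingerR_eq_of_subset g A A' N hA'sub hg0, real_fingerR_eq_of_subset g A A' N hA'sub hg0]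
  exact h3

/-- **`stub_fingerML3_vp` when the fingers touch at most two relays (one may be `b`), any `A`.**  Stub setting; fingers pairwise non-adjacent;
every pair from `N` to a relay other than `w₁, w₂` has weight `0`.  Then `μ_{K/N}(R ∩ {d↔b}) ≤ μ_{K/N}(R ∩ ⋃_{v∈N}{v↔b})`.
[cite: KozmaNitzan2024, Lemma 3 (pp. 6–7), §3.2 pp. 12–14, §4 p. 20, Question 9 (p. 36)] -/
theorem fingerML3_twoTouched_withB (K : Sym2 (Fin n) → unitInterval) (A N : Finset (Fin n)) (d b w₁ w₂ : Fin n)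
    (hb : b ∈ A) (hNA : Disjoint N A) (hd : d ∈ A)
    (hfree : ∀ v ∈ N, ∀ y : Fin n, y ∉ A → y ∉ N → (K s(v, y) : ℝ) = 0)
    (hle : ∀ a ∈ A, (prodBernoulli K).real (openConn d b) ≤ (prodBernoulli K).real (openConn a b))
    (htwo : ∀ v ∈ N, ∀ a ∈ A, a ≠ w₁ → a ≠ w₂ → (K s(v, a) : ℝ) = 0)
    (hint : ∀ v ∈ N, ∀ v' ∈ N, v ≠ v' → (K s(v, v') : ℝ) = 0) :
    (prodBernoulli (fun e' : Sym2 (Fin n) => if (∀ y ∈ e', y ∈ N) ∧ ¬ e'.IsDiag then 1 else K e')).real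
        ({ω : Set (Sym2 (Fin n)) | ∃ v ∈ N, ∃ a ∈ A, s(v, a) ∈ ω} ∩ openConn d b) ≤
      (prodBernoulli (fun e' : Sym2 (Fin n) => if (∀ y ∈ e', y ∈ N) ∧ ¬ e'.IsDiag then 1 else K e')).real
        ({ω : Set (Sym2 (Fin n)) | ∃ v ∈ N, ∃ a ∈ A, s(v, a) ∈ ω} ∩ ⋃ v ∈ N, openConn v b) := by
  by_cases h1 : w₁ = b
  · subst h1
    exact fingerML3_touched_b_and_one K A N d w₁ w₂ hb hNA hd hfree hle
      (fun v hv a ha haw hab => htwo v hv a ha hab haw)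
  by_cases h2 : w₂ = b
  · subst h2
    exact fingerML3_touched_b_and_one K A N d w₂ w₁ hb hNA hd hfree hle
      (fun v hv a ha haw hab => htwo v hv a ha haw hab)
  exact fingerML3_twoTouched K A N d b w₁ w₂ hb hNA hd h1 h2 hfree hle htwo hint

end FingerTwoTouchedB

end

end Summit.CriticalPhenomena.PercolationContinuityZ3.Theorems
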